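import Mathlib.MeasureTheory.Measure.Lebesgue.Basic
import Mathlib.Topology.MetricSpace.Thickening
import Literature.Analysis.Fourier.FractalUncertaintyPrinciple
import HarnessLib

/-!
# Operations preserving `δ`-regularity (Bourgain–Dyatlov 2018, §2.2)

Topic `Literature/Analysis/Fourier`; companion to `FractalUncertaintyPrinciple.lean`
(`IsRegularSet X δ C_R α₀ α₁` = BD18 Definition 1.1). J. Bourgain, S. Dyatlov, *Spectral gaps
without the pressure condition*, Ann. of Math. 187 (2018), §2.2 shows that natural operations
preserve the family of `δ`-regular sets at the price of a larger regularity constant and a smaller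
range of scales. Proved here (sorry-free), in the order of the paper:

* `IsRegularSet.mono_scales`, `IsRegularSet.mono_const` — shrinking the scales / enlarging `C_R`;
* `IsRegularSet.affine` — affine images `y + cX` (scales `cα₀` to `cα₁`, same constant);
* `IsRegularSet.upper_scale` — increasing the upper scale to `Tα₁` (constant `2TC_R`);
* `IsRegularSet.cthickening` — the neighbourhood `X(Tα₀) = X + [-Tα₀, Tα₀]`, rendered as
  `Metric.cthickening (Tα₀) X` (scales `2α₀` to `α₁`; constant `10TC_R` — the paper prints
  `4TC_R` for an averaged-translate witness, we use a discrete average of translates);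
* `IsRegularSet.inter_Icc` — intersections with intervals `X ∩ J` when `X ∩ J' ⊂ J`.

Deliberately NOT here: nonlinear images (BD18 §2.2, `C¹` diffeomorphisms; not needed for
Theorem 4), the splitting lemma and the small-cover lemma (used in BD18 §4 and §3.1), the missing
subinterval property (see `RegularSetsPorosity.lean`).
-/

namespace Literature.Analysis.Fourier

open _root_.MeasureTheory Set
open scoped ENNReal

variable {X : Set ℝ} {δ C_R α₀ α₁ : ℝ}

/-- Shrinking the range of scales preserves regularity (fewer intervals are constrained).
[cite: BourgainDyatlov2018, Definition 1.1] -/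
theorem IsRegularSet.mono_scales (h : IsRegularSet X δ C_R α₀ α₁) {α₀' α₁' : ℝ}
    (h₀ : α₀ ≤ α₀') (h₁ : α₁' ≤ α₁) : IsRegularSet X δ C_R α₀' α₁' := by
  obtain ⟨hne, hcl, μ, hμX, hμ⟩ := h
  exact ⟨hne, hcl, μ, hμX, fun a b hab ha hb => hμ a b hab (h₀.trans ha) (hb.trans h₁)⟩

/-- Increasing the regularity constant preserves regularity.
[cite: BourgainDyatlov2018, Definition 1.1] -/
theorem IsRegularSet.mono_const (h : IsRegularSet X δ C_R α₀ α₁) (hC : 0 < C_R) {C' : ℝ}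
    (hC' : C_R ≤ C') : IsRegularSet X δ C' α₀ α₁ := by
  obtain ⟨hne, hcl, μ, hμX, hμ⟩ := h
  refine ⟨hne, hcl, μ, hμX, fun a b hab ha hb => ?_⟩
  obtain ⟨hup, hlow⟩ := hμ a b hab ha hb
  have hpow : 0 ≤ (b - a) ^ δ := Real.rpow_nonneg (by linarith) δ
  refine ⟨hup.trans (ENNReal.ofReal_le_ofReal ?_), fun hm => (ENNReal.ofReal_le_ofReal ?_).trans (hlow hm)⟩
  · exact mul_le_mul_of_nonneg_right hC' hpow
  · apply mul_le_mul_of_nonneg_right _ hpow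
    exact inv_anti₀ hC hC'

/-- **Affine images** (BD18 Lemma 2.1): if `X` is `δ`-regular with constant `C_R` on scales `α₀`
to `α₁`, `c > 0`, `y ∈ ℝ`, then `y + cX` is `δ`-regular with constant `C_R` on scales `cα₀` to
`cα₁` (witness measure `c^δ · (x ↦ y + cx)_* μ_X`). [cite: BourgainDyatlov2018, Lemma 2.1] -/
theorem IsRegularSet.affine (h : IsRegularSet X δ C_R α₀ α₁) {c : ℝ} (hc : 0 < c) (y : ℝ) :
    IsRegularSet ((fun x => y + c * x) '' X) δ C_R (c * α₀) (c * α₁) := by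
  obtain ⟨hne, hcl, μ, hμX, hμ⟩ := h
  set e : ℝ ≃ₜ ℝ := (Homeomorph.mulLeft₀ c hc.ne').trans (Homeomorph.addLeft y) with he
  have hfun : (fun x => y + c * x) = e := by
    funext x
    simp [he]
  rw [hfun]
  have hcδ : 0 < c ^ δ := Real.rpow_pos_of_pos hc δ
  refine ⟨hne.image _, e.isClosed_image.2 hcl, ENNReal.ofReal (c ^ δ) • μ.map e, ?_, ?_⟩
  · rw [Measure.smul_apply, Measure.map_apply e.continuous.measurable
      (e.isClosed_image.2 hcl).measurableSet.compl, Set.preimage_compl,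
      Set.preimage_image_eq _ e.injective, hμX, smul_zero]
  intro a b hab ha hb
  have hpre : e ⁻¹' Icc a b = Icc ((a - y) / c) ((b - y) / c) := by
    ext x
    simp only [he, mem_preimage, Homeomorph.trans_apply, Homeomorph.coe_mulLeft₀,
      Homeomorph.coe_addLeft, mem_Icc]
    rw [le_div_iff₀ hc, div_le_iff₀ hc]
    constructor <;> rintro ⟨h1, h2⟩ <;> constructor <;> linarith
  have hlen : (b - y) / c - (a - y) / c = (b - a) / c := by ring
  have hab' : (a - y) / c < (b - y) / c := by
    rw [div_lt_div_iff_of_pos_right hc]; linarith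
  have ha' : α₀ ≤ (b - y) / c - (a - y) / c := by
    rw [hlen, le_div_iff₀ hc]; linarith
  have hb' : (b - y) / c - (a - y) / c ≤ α₁ := by
    rw [hlen, div_le_iff₀ hc]; linarith
  obtain ⟨hup, hlow⟩ := hμ _ _ hab' ha' hb'
  rw [hlen] at hup hlow
  have hpowdiv : ((b - a) / c) ^ δ = (b - a) ^ δ / c ^ δ :=
    Real.div_rpow (by linarith) hc.le δ
  rw [Measure.smul_apply, Measure.map_apply e.continuous.measurable measurableSet_Icc, hpre,
    smul_eq_mul]
  constructor
  · calc ENNReal.ofReal (c ^ δ) * μ (Icc ((a - y) / c) ((b - y) / c))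
        ≤ ENNReal.ofReal (c ^ δ) * ENNReal.ofReal (C_R * ((b - a) / c) ^ δ) := by gcongr
      _ = ENNReal.ofReal (C_R * (b - a) ^ δ) := by
        rw [← ENNReal.ofReal_mul hcδ.le, hpowdiv]
        congr 1
        field_simp
  · intro hmid
    have hmid' : ((a - y) / c + (b - y) / c) / 2 ∈ X := by
      obtain ⟨x, hx, hxe⟩ := hmid
      have : x = ((a - y) / c + (b - y) / c) / 2 := by
        simp only [he, Homeomorph.trans_apply, Homeomorph.coe_mulLeft₀,
          Homeomorph.coe_addLeft] at hxe
        field_simp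
        linarith
      rw [← this]; exact hx
    calc ENNReal.ofReal (C_R⁻¹ * (b - a) ^ δ)
        = ENNReal.ofReal (c ^ δ) * ENNReal.ofReal (C_R⁻¹ * ((b - a) / c) ^ δ) := by
          rw [← ENNReal.ofReal_mul hcδ.le, hpowdiv]
          congr 1
          field_simp
      _ ≤ ENNReal.ofReal (c ^ δ) * μ (Icc ((a - y) / c) ((b - y) / c)) := by
          gcongr
          exact hlow hmid'

/-- **Increasing the upper scale** (BD18 Lemma 2.2): if `X` is `δ`-regular (`0 ≤ δ ≤ 1`) with
constant `C_R > 0` on scales `α₀` to `α₁ ≥ α₀` and `T ≥ 1`, then `X` is `δ`-regular with constant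
`2 T C_R` on scales `α₀` to `T α₁`. [cite: BourgainDyatlov2018, Lemma 2.2] -/
theorem IsRegularSet.upper_scale (h : IsRegularSet X δ C_R α₀ α₁) (hδ : 0 ≤ δ) (hδ1 : δ ≤ 1)
    (hC : 0 < C_R) (hα : α₀ ≤ α₁) {T : ℝ} (hT : 1 ≤ T) :
    IsRegularSet X δ (2 * T * C_R) α₀ (T * α₁) := by
  obtain ⟨hne, hcl, μ, hμX, hμ⟩ := h
  refine ⟨hne, hcl, μ, hμX, fun a b hab ha hb => ?_⟩
  have hpow : 0 ≤ (b - a) ^ δ := Real.rpow_nonneg (by linarith) δ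
  by_cases hsmall : b - a ≤ α₁
  · obtain ⟨hup, hlow⟩ := hμ a b hab ha hsmall
    constructor
    · refine hup.trans (ENNReal.ofReal_le_ofReal (mul_le_mul_of_nonneg_right ?_ hpow))
      nlinarith
    · intro hm
      refine (ENNReal.ofReal_le_ofReal (mul_le_mul_of_nonneg_right ?_ hpow)).trans (hlow hm)
      apply inv_anti₀ hC
      nlinarith
  push Not at hsmall
  have hα₁ : 0 < α₁ := by
    by_contra h0
    push Not at h0
    nlinarith
  constructor
  · -- cover `[a, b]` by `n + 1` intervals of length `α₁`, `n = ⌊(b - a)/α₁⌋₊ ≤ T`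
    classical
    set n : ℕ := ⌊(b - a) / α₁⌋₊ with hn
    have hnT : (n : ℝ) ≤ T := by
      have : (n : ℝ) ≤ (b - a) / α₁ := Nat.floor_le (by positivity)
      exact this.trans (by rw [div_le_iff₀ hα₁]; linarith)
    set J : ℕ → Set ℝ := fun k => Icc (a + k * α₁) (a + (k + 1) * α₁) with hJ
    have hcover : Icc a b ⊆ ⋃ k ∈ Finset.range (n + 1), J k := by
      intro x hx
      set k : ℕ := ⌊(x - a) / α₁⌋₊ with hk
      have hk1 : (k : ℝ) ≤ (x - a) / α₁ := Nat.floor_le (by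
        have := hx.1; positivity)
      have hk2 : (x - a) / α₁ < k + 1 := Nat.lt_floor_add_one _
      have hkn : k ≤ n := Nat.floor_le_floor (by gcongr; exact hx.2)
      refine Set.mem_iUnion₂.mpr ⟨k, Finset.mem_range.2 (Nat.lt_succ_of_le hkn), ?_⟩
      simp only [hJ, mem_Icc]
      rw [le_div_iff₀ hα₁] at hk1
      rw [div_lt_iff₀ hα₁] at hk2
      constructor <;> linarith
    have hJb : ∀ k : ℕ, μ (J k) ≤ ENNReal.ofReal (C_R * α₁ ^ δ) := by
      intro k
      have := (hμ (a + k * α₁) (a + (k + 1) * α₁) (by linarith) (by ring_nf; linarith)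
        (le_of_eq (by ring))).1
      have hlen : a + (k + 1) * α₁ - (a + k * α₁) = α₁ := by ring
      rwa [hlen] at this
    calc μ (Icc a b) ≤ μ (⋃ k ∈ Finset.range (n + 1), J k) := measure_mono hcover
      _ ≤ ∑ k ∈ Finset.range (n + 1), μ (J k) := measure_biUnion_finset_le _ _
      _ ≤ ∑ k ∈ Finset.range (n + 1), ENNReal.ofReal (C_R * α₁ ^ δ) :=
          Finset.sum_le_sum fun k _ => hJb k
      _ = ENNReal.ofReal ((n + 1) * (C_R * α₁ ^ δ)) := by
          rw [Finset.sum_const, Finset.card_range, nsmul_eq_mul,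
            ENNReal.ofReal_mul' (by positivity : (0 : ℝ) ≤ C_R * α₁ ^ δ)]
          congr 1
          rw [← ENNReal.ofReal_natCast]
          push_cast
          rfl
      _ ≤ ENNReal.ofReal (2 * T * C_R * (b - a) ^ δ) := by
          apply ENNReal.ofReal_le_ofReal
          have h1 : (n : ℝ) + 1 ≤ 2 * T := by linarith
          have h2 : α₁ ^ δ ≤ (b - a) ^ δ := Real.rpow_le_rpow hα₁.le hsmall.le hδ
          calc ((n : ℝ) + 1) * (C_R * α₁ ^ δ) ≤ (2 * T) * (C_R * (b - a) ^ δ) := by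
                gcongr
            _ = 2 * T * C_R * (b - a) ^ δ := by ring
  · intro hm
    -- the sub-interval of length `α₁` with the same centre
    set c := (a + b) / 2 with hc
    obtain ⟨-, hlow⟩ := hμ (c - α₁ / 2) (c + α₁ / 2) (by linarith) (by linarith) (by linarith)
    have hlen : c + α₁ / 2 - (c - α₁ / 2) = α₁ := by ring
    have hmid : (c - α₁ / 2 + (c + α₁ / 2)) / 2 = c := by ring
    rw [hlen, hmid] at hlow
    have hsub : Icc (c - α₁ / 2) (c + α₁ / 2) ⊆ Icc a b := by
      apply Icc_subset_Icc <;> · rw [hc]; linarith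
    calc ENNReal.ofReal ((2 * T * C_R)⁻¹ * (b - a) ^ δ)
        ≤ ENNReal.ofReal (C_R⁻¹ * α₁ ^ δ) := by
          apply ENNReal.ofReal_le_ofReal
          -- (b-a)^δ ≤ (T α₁)^δ ≤ T α₁^δ ≤ 2 T α₁^δ
          have h1 : (b - a) ^ δ ≤ (T * α₁) ^ δ := Real.rpow_le_rpow (by linarith) hb hδ
          have h2 : (T * α₁) ^ δ = T ^ δ * α₁ ^ δ := Real.mul_rpow (by linarith) hα₁.le
          have h3 : T ^ δ ≤ T := by
            calc T ^ δ ≤ T ^ (1 : ℝ) := Real.rpow_le_rpow_of_exponent_le hT hδ1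
              _ = T := Real.rpow_one T
          have h4 : 0 ≤ α₁ ^ δ := Real.rpow_nonneg hα₁.le δ
          rw [mul_inv, mul_inv]
          calc 2⁻¹ * T⁻¹ * C_R⁻¹ * (b - a) ^ δ ≤ 2⁻¹ * T⁻¹ * C_R⁻¹ * (T * α₁ ^ δ) := by
                gcongr
                calc (b - a) ^ δ ≤ T ^ δ * α₁ ^ δ := h2 ▸ h1
                  _ ≤ T * α₁ ^ δ := by gcongr
            _ = 2⁻¹ * (C_R⁻¹ * α₁ ^ δ) := by field_simp
            _ ≤ 1 * (C_R⁻¹ * α₁ ^ δ) := by gcongr; norm_num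
            _ = C_R⁻¹ * α₁ ^ δ := one_mul _
      _ ≤ μ (Icc (c - α₁ / 2) (c + α₁ / 2)) := hlow hm
      _ ≤ μ (Icc a b) := measure_mono hsub

/-- **Neighbourhoods** (BD18 §2.2): if `X` is `δ`-regular (`0 ≤ δ ≤ 1`) with constant `C_R > 0`
on scales `α₀ > 0` to `α₁` and `T ≥ 1`, then the closed `Tα₀`-neighbourhood
`X(Tα₀) = X + [-Tα₀, Tα₀]` (`Metric.cthickening (T α₀) X`) is `δ`-regular with constant
`10 T C_R` on scales `2α₀` to `α₁`. The paper prints the constant `4 T C_R` for the witness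
`A ↦ (Tα₀)⁻¹ ∫_{-Tα₀}^{Tα₀} μ_X(A + y) dy`; here the witness is the discrete average of the
translates of `μ_X` by `k α₀ / 2`, `|k| ≤ ⌊2T⌋`, which avoids Fubini.
[cite: BourgainDyatlov2018, §2.2, Lemma "Neighborhoods"] -/
theorem IsRegularSet.cthickening (h : IsRegularSet X δ C_R α₀ α₁) (hδ1 : δ ≤ 1)
    (hC : 0 < C_R) (hα₀ : 0 < α₀) {T : ℝ} (hT : 1 ≤ T) :
    IsRegularSet (Metric.cthickening (T * α₀) X) δ (10 * T * C_R) (2 * α₀) α₁ := by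
  classical
  obtain ⟨hne, hcl, μ, hμX, hμ⟩ := h
  have hTα : 0 ≤ T * α₀ := by positivity
  set s : ℝ := α₀ / 2 with hs
  have hs0 : 0 < s := by positivity
  set m : ℕ := ⌊2 * T⌋₊ with hm
  have hm1 : (m : ℝ) ≤ 2 * T := Nat.floor_le (by positivity)
  have hm2 : 2 * T < m + 1 := Nat.lt_floor_add_one _
  set w : ℝ := ((2 * m + 1 : ℝ))⁻¹ with hw
  have hw0 : 0 < w := by positivity
  set f : ℤ → ℝ → ℝ := fun k x => x + k * s with hf
  have hfm : ∀ k, Measurable (f k) := fun k => (measurable_id.add_const _)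
  set K : Finset ℤ := Finset.Icc (-(m : ℤ)) m with hK
  have hKcard : (K.card : ℝ) = 2 * m + 1 := by
    have : K.card = 2 * m + 1 := by
      simp only [hK, Int.card_Icc]
      omega
    rw [this]; push_cast; ring
  set ν : Measure ℝ := ENNReal.ofReal w • ∑ k ∈ K, μ.map (f k) with hν
  have hν_apply : ∀ A : Set ℝ, MeasurableSet A →
      ν A = ENNReal.ofReal w * ∑ k ∈ K, μ (f k ⁻¹' A) := by
    intro A hA
    simp only [hν, Measure.smul_apply, Measure.coe_finsetSum, Finset.sum_apply, smul_eq_mul]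
    congr 1
    refine Finset.sum_congr rfl fun k _ => ?_
    rw [Measure.map_apply (hfm k) hA]
  have hpre : ∀ (k : ℤ) (a b : ℝ), f k ⁻¹' Icc a b = Icc (a - k * s) (b - k * s) := by
    intro k a b
    ext x
    simp only [hf, mem_preimage, mem_Icc]
    constructor <;> rintro ⟨h1, h2⟩ <;> constructor <;> linarith
  refine ⟨hne.mono (Metric.self_subset_cthickening X), Metric.isClosed_cthickening, ν, ?_, ?_⟩
  · -- support
    rw [hν_apply _ Metric.isClosed_cthickening.measurableSet.compl]
    have : ∀ k ∈ K, μ (f k ⁻¹' (Metric.cthickening (T * α₀) X)ᶜ) = 0 := by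
      intro k hk
      apply measure_mono_null _ hμX
      intro x hx hxX
      apply hx
      simp only [hf]
      apply Metric.mem_cthickening_of_dist_le _ x _ _ hxX
      have hk' : |(k : ℝ)| ≤ m := by
        rw [hK, Finset.mem_Icc] at hk
        rw [abs_le]
        exact ⟨by exact_mod_cast hk.1, by exact_mod_cast hk.2⟩
      rw [Real.dist_eq, show x + k * s - x = k * s by ring, abs_mul, abs_of_pos hs0]
      calc |(k : ℝ)| * s ≤ m * s := by gcongr
        _ ≤ 2 * T * s := by gcongr
        _ = T * α₀ := by rw [hs]; ring
    rw [Finset.sum_eq_zero this, mul_zero]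
  intro a b hab ha hb
  have hpow : 0 ≤ (b - a) ^ δ := Real.rpow_nonneg (by linarith) δ
  rw [hν_apply _ measurableSet_Icc]
  constructor
  · -- upper bound: each translate has mass ≤ C_R (b-a)^δ
    have hkb : ∀ k ∈ K, μ (f k ⁻¹' Icc a b) ≤ ENNReal.ofReal (C_R * (b - a) ^ δ) := by
      intro k _
      rw [hpre]
      have := (hμ (a - k * s) (b - k * s) (by linarith) (by linarith) (by linarith)).1
      rwa [show b - k * s - (a - k * s) = b - a by ring] at this
    calc ENNReal.ofReal w * ∑ k ∈ K, μ (f k ⁻¹' Icc a b)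
        ≤ ENNReal.ofReal w * ∑ k ∈ K, ENNReal.ofReal (C_R * (b - a) ^ δ) := by
          gcongr with k hk
          exact hkb k hk
      _ = ENNReal.ofReal (C_R * (b - a) ^ δ) := by
          rw [Finset.sum_const, nsmul_eq_mul, ← ENNReal.ofReal_natCast, hKcard, ← mul_assoc,
            ← ENNReal.ofReal_mul hw0.le, hw, inv_mul_cancel₀ (by positivity), ENNReal.ofReal_one,
            one_mul]
      _ ≤ ENNReal.ofReal (10 * T * C_R * (b - a) ^ δ) := by
          apply ENNReal.ofReal_le_ofReal
          apply mul_le_mul_of_nonneg_right _ hpow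
          nlinarith
  · -- lower bound
    intro hmid
    set c := (a + b) / 2 with hc
    rw [hcl.cthickening_eq_biUnion_closedBall hTα, Set.mem_iUnion₂] at hmid
    obtain ⟨x₀, hx₀, hcx₀⟩ := hmid
    rw [Metric.mem_closedBall, Real.dist_eq] at hcx₀
    set d := c - x₀ with hd
    -- choose the translate
    set k₀ : ℤ := round (d / s) with hk₀
    set k : ℤ := max (-(m : ℤ)) (min m k₀) with hkdef
    have hkK : k ∈ K := by
      rw [hK, Finset.mem_Icc]
      constructor
      · exact le_max_left _ _
      · exact max_le (by linarith) (min_le_left _ _)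
    have hround : |d / s - k₀| ≤ 1 / 2 := abs_sub_round _
    have hks : |k * s - d| ≤ s := by
      have hds : |d / s| ≤ 2 * T := by
        rw [abs_div, abs_of_pos hs0, div_le_iff₀ hs0]
        calc |d| ≤ T * α₀ := hcx₀
          _ = 2 * T * s := by rw [hs]; ring
      rw [abs_le] at hround hds ⊢
      have e : (k : ℝ) * s - d = (k - d / s) * s := by field_simp
      rw [e]
      have hkR : (k : ℝ) = max (-(m : ℝ)) (min (m : ℝ) (k₀ : ℝ)) := by
        rw [hkdef]; push_cast; rfl
      have hk1 : -1 ≤ (k : ℝ) - d / s ∧ (k : ℝ) - d / s ≤ 1 := by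
        rw [hkR]
        rcases le_total (m : ℝ) (k₀ : ℝ) with h1 | h1
        · rw [min_eq_left h1, max_eq_right (by linarith)]
          constructor <;> linarith
        · rw [min_eq_right h1]
          rcases le_total (-(m : ℝ)) (k₀ : ℝ) with h2 | h2
          · rw [max_eq_right h2]; constructor <;> linarith
          · rw [max_eq_left h2]; constructor <;> linarith
      constructor <;> nlinarith
    -- the interval of size (b-a)/2 centred at x₀ sits inside the k-th translate of [a,b]
    obtain ⟨-, hlow⟩ := hμ (x₀ - (b - a) / 4) (x₀ + (b - a) / 4) (by linarith) (by linarith)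
      (by linarith)
    have hlen : x₀ + (b - a) / 4 - (x₀ - (b - a) / 4) = (b - a) / 2 := by ring
    have hmid' : (x₀ - (b - a) / 4 + (x₀ + (b - a) / 4)) / 2 = x₀ := by ring
    rw [hlen, hmid'] at hlow
    have hsub : Icc (x₀ - (b - a) / 4) (x₀ + (b - a) / 4) ⊆ f k ⁻¹' Icc a b := by
      rw [hpre]
      rw [abs_le] at hks
      have hca : a = c - (b - a) / 2 := by rw [hc]; ring
      have hcb : b = c + (b - a) / 2 := by rw [hc]; ring
      apply Icc_subset_Icc
      · rw [hca]; linarith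
      · rw [hcb]; linarith
    calc ENNReal.ofReal ((10 * T * C_R)⁻¹ * (b - a) ^ δ)
        ≤ ENNReal.ofReal w * ENNReal.ofReal (C_R⁻¹ * ((b - a) / 2) ^ δ) := by
          rw [← ENNReal.ofReal_mul hw0.le]
          apply ENNReal.ofReal_le_ofReal
          -- ((b-a)/2)^δ ≥ (b-a)^δ / 2 and w ≥ 1/(5T)
          have h2δ : (2 : ℝ) ^ δ ≤ 2 := by
            calc (2 : ℝ) ^ δ ≤ 2 ^ (1 : ℝ) := Real.rpow_le_rpow_of_exponent_le (by norm_num) hδ1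
              _ = 2 := Real.rpow_one 2
          have h1 : (b - a) ^ δ / 2 ≤ ((b - a) / 2) ^ δ := by
            rw [Real.div_rpow (by linarith) (by norm_num)]
            exact div_le_div_of_nonneg_left hpow (Real.rpow_pos_of_pos (by norm_num) δ) h2δ
          have h2 : (5 * T)⁻¹ ≤ w := by
            rw [hw]; apply inv_anti₀ (by positivity); linarith
          calc (10 * T * C_R)⁻¹ * (b - a) ^ δ = (5 * T)⁻¹ * (C_R⁻¹ * ((b - a) ^ δ / 2)) := by
                field_simp; ring
            _ ≤ w * (C_R⁻¹ * ((b - a) / 2) ^ δ) := by gcongr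
      _ ≤ ENNReal.ofReal w * μ (Icc (x₀ - (b - a) / 4) (x₀ + (b - a) / 4)) := by
          gcongr; exact hlow hx₀
      _ ≤ ENNReal.ofReal w * μ (f k ⁻¹' Icc a b) := by gcongr
      _ ≤ ENNReal.ofReal w * ∑ k ∈ K, μ (f k ⁻¹' Icc a b) := by
          gcongr
          exact Finset.single_le_sum (f := fun k => μ (f k ⁻¹' Icc a b)) (fun _ _ => zero_le) hkK

/-- **Intersections with intervals** (BD18 Lemma 2.5): let `X` be `δ`-regular with constant `C_R`
on scales `α₀` to `α₁`, and let `J = [c-r, c+r] ⊂ J' = [c-r', c+r']` be concentric closed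
intervals with `X ∩ J ≠ ∅` and `X ∩ J' ⊂ J`. Then `X ∩ J` is `δ`-regular with constant `C_R` on
scales `α₀` to `min α₁ (2r' - 2r)` (the paper adds `2r' - 2r ≥ α₀`, only to make this range of
scales nonempty). [cite: BourgainDyatlov2018, Lemma 2.5] -/
theorem IsRegularSet.inter_Icc (h : IsRegularSet X δ C_R α₀ α₁) {c r r' : ℝ}
    (hne : (X ∩ Icc (c - r) (c + r)).Nonempty)
    (hsub : X ∩ Icc (c - r') (c + r') ⊆ Icc (c - r) (c + r)) :
    IsRegularSet (X ∩ Icc (c - r) (c + r)) δ C_R α₀ (min α₁ (2 * r' - 2 * r)) := by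
  obtain ⟨-, hcl, μ, hμX, hμ⟩ := h
  refine ⟨hne, hcl.inter isClosed_Icc, μ.restrict (Icc (c - r') (c + r')), ?_, ?_⟩
  · rw [Measure.restrict_apply (hcl.inter isClosed_Icc).measurableSet.compl]
    apply measure_mono_null _ hμX
    intro x ⟨hx1, hx2⟩ hxX
    exact hx1 ⟨hxX, hsub ⟨hxX, hx2⟩⟩
  intro a b hab ha hb
  obtain ⟨hup, hlow⟩ := hμ a b hab ha (hb.trans (min_le_left _ _))
  rw [Measure.restrict_apply measurableSet_Icc]
  refine ⟨(measure_mono Set.inter_subset_left).trans hup, fun hm => ?_⟩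
  have hI : Icc a b ⊆ Icc (c - r') (c + r') := by
    have hm2 := hm.2
    simp only [mem_Icc] at hm2
    have hb' := hb.trans (min_le_right _ _)
    apply Icc_subset_Icc <;> linarith
  rw [Set.inter_eq_left.2 hI]
  exact hlow hm.1


end Literature.Analysis.Fourier
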